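import Summits.QuantumFields.YangMills.Theorems.CurvatureBoostCovariance.Negative.Unbundled
import Summits.QuantumFields.YangMills.Theorems.NPointIsotropy.Negative.DegreeTwoFree
import Summits.QuantumFields.YangMills.Theorems.PencilRigidityNPointIsotropyBandlimit
import Summits.QuantumFields.YangMills.Theorems.PencilRigidityKernelTransfer
import Summits.QuantumFields.YangMills.Theses.PencilRigidity
import Literature.MathematicalPhysics.QuantumFieldTheory.OSLorentzInvariance
import Literature.MathematicalPhysics.QuantumFieldTheory.SchwingerLimitInheritance

/-!
# Level growth at the OS levels `a ≤ 1` — stub `stub_levelGrowthLow`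

Line `boosts-inherit-mirrors` of crux `MirrorModularBoosts.CurvatureBoostCovariance` (stmt-QuantumFields-9663),
Stub 5a of the registered skeleton `Cruxes/CurvatureBoostCovariance/Lines/boosts_inherit_mirrors.lean`
(reshape 4): the diagonal doubled pencil of a degree-`a` block, `a ≤ 1`, has no layer `|k| ≥ 2` — in fact no
layer `k ≠ 0` — given the two PencilRigidity items `CurvatureKernelBound` (stmt-QuantumFields-11687) and
`ShellRigidity` (stmt-QuantumFields-11685) as explicit leading hypotheses BY NAME.

Proof.
* The orbit function `θ ↦ S₁ (a + a) (R_θ · H)` (`R_θ = planeRot 0 θ`) of the doubled test function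
  `H = ΘF* ⊗ F` is CONSTANT:
  - `a = 0`: `Fin (0 + 0) → ℝ⁴` is a one-point space, so the diagonal action `linActMulti R_θ` is the identity;
  - `a = 1`: `CurvatureKernelBound` (at the Borel structure of `G`, which is the given one by `BorelSpace`)
    produces the real two-point kernel `K` of `S₁` on `⁰𝒮` with its UV bound; the landed item `KernelTransfer`
    (`Theorems.KernelTransfer.kernelTransfer_proof`, stmt-QuantumFields-11688), fed E3 and proper hypercubic
    invariance from `W1` and the eight frames, gives `W(B₄)`-invariance and axis/diagonal pointwise
    OS-positivity of `K`; `ShellRigidity` makes `K` radial off `0`, i.e. `RadialKernel S₁`; the landed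
    `NPointIsotropy.Negative.radialKernel_invariant_two` makes `S₁ 2` invariant on `⁰𝒮` under EVERY isometry, in
    particular under `R_θ`; and `H` is off-diagonal (`IsAppendTensorOf.isOffDiagonal_of_isTimeOrdered`: `ΘF*`
    lives at negative, `F` at positive times).
* Uniqueness of trigonometric coefficients (`trigPoly_coeff_eq_zero_of_const`): a trigonometric polynomial
  `∑_{|k| ≤ K} p_k e^{4ikθ}` constant on `ℝ` has `p_k = 0` for `k ≠ 0` — on the circle `ℝ/(π/2)ℤ`, whose Fourier
  monomials are `e^{4ikθ}` (`fourier_quarterCircle_apply`), its `k`-th Fourier coefficient is `p_k` (Mathlib's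
  `fourierCoeff_fourier`) and that of a constant vanishes for `k ≠ 0`.
The induction hypothesis of Stub 5 (planar invariance in degrees `≤ 2a - 2`), the cone and the compact support
of `F` are not used at these levels.

References: Osterwalder–Schrader 1973 §4; Glimm–Jaffe 1987 §6.1 (OS positivity, doubled test functions);
Mathlib `Analysis/Fourier/AddCircle` (Fourier coefficients on `AddCircle`).
-/

noncomputable section


namespace Summit.QuantumFields.YangMills.Theorems.CurvatureBoostCovariance.BoostsInheritMirrors

open scoped BigOperators SchwartzMap
open MeasureTheory Filter Topology AddCircle
open Literature.MathematicalPhysics.QuantumLattice Literature.MathematicalPhysics.AQFT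
  Literature.MathematicalPhysics.QuantumFieldTheory
open Summit.QuantumFields.YangMills.Theorems.NPointIsotropy.Negative (E4 RadialKernel radialKernel_invariant_two)
open Summit.QuantumFields.YangMills.Theorems.NPointIsotropy.ComplexRotationBandlimit (fourier_quarterCircle_apply)
open Summit.QuantumFields.YangMills.Theorems.CurvatureBoostCovariance.Negative
  (OSPackage Translations Hypercubic EightFrameRP PlanarCone PlanarInvariant Tie Gaps W1)

/-! ## Uniqueness of trigonometric coefficients -/

/-- Uniqueness of trigonometric coefficients: if `∑_{|k| ≤ K} p_k e^{4ikθ}` is constant on `ℝ`, then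
`p_k = 0` for every `k ≠ 0` in the range (the `k`-th Fourier coefficient on the circle `ℝ/(π/2)ℤ` of the
left side is `p_k`, Mathlib's `fourierCoeff_fourier`; that of a constant vanishes for `k ≠ 0`). -/
theorem trigPoly_coeff_eq_zero_of_const (K : ℕ) (p : ℤ → ℂ) (c : ℂ)
    (h : ∀ θ : ℝ, ∑ k ∈ Finset.Icc (-(K : ℤ)) K,
      p k * Complex.exp (4 * (k : ℂ) * (θ : ℂ) * Complex.I) = c) :
    ∀ k ∈ Finset.Icc (-(K : ℤ)) K, k ≠ 0 → p k = 0 := by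
  haveI hT : Fact (0 < Real.pi / 2) := ⟨by positivity⟩
  intro l hl hl0
  set g : AddCircle (Real.pi / 2) → ℂ :=
    fun t => ∑ k ∈ Finset.Icc (-(K : ℤ)) K, p k * fourier k t with hg_def
  -- (1) the `l`-th Fourier coefficient of `g` is `p l`
  have h1 : fourierCoeff g l = p l := by
    have hg' : g = ∑ k ∈ Finset.Icc (-(K : ℤ)) K,
        fun t : AddCircle (Real.pi / 2) => p k * fourier k t := by
      funext t
      simp only [hg_def, Finset.sum_apply]
    have hint : ∀ k ∈ Finset.Icc (-(K : ℤ)) K,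
        Integrable (fun t : AddCircle (Real.pi / 2) => p k * fourier k t) haarAddCircle :=
      fun k _ => ((continuous_const.mul (map_continuous (fourier k))).integrable_of_hasCompactSupport
        (HasCompactSupport.of_compactSpace _))
    rw [hg', fourierCoeff.sum _ _ hint, Finset.sum_apply]
    simp_rw [fourierCoeff.const_mul, fourierCoeff_fourier]
    rw [Finset.sum_eq_single l]
    · simp
    · intro k _ hkl
      simp [Ne.symm hkl]
    · intro hl'
      exact absurd hl hl'
  -- (2) `g` is the constant `c = c • e₀`, whose `l`-th coefficient vanishes
  have h2 : g = fun t => c * fourier 0 t := by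
    funext t
    induction t using QuotientAddGroup.induction_on with
    | H θ =>
      simp only [hg_def, fourier_zero, mul_one]
      rw [← h θ]
      exact Finset.sum_congr rfl fun k _ => by rw [fourier_quarterCircle_apply]
  have h3 : fourierCoeff g l = 0 := by
    rw [h2, fourierCoeff.const_mul, fourierCoeff_fourier, Pi.single_apply, if_neg hl0, mul_zero]
  exact h1.symm.trans h3

/-! ## Level `a = 1`: the two-point kernel is radial -/

/-- **Level one input.**  `CurvatureKernelBound` + the landed `KernelTransfer` + `ShellRigidity` make the two-point
kernel of every family with the curvature package and the eight frames radial (`RadialKernel`), for an arbitrary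
Borel structure on `G` (it is `borel G` by `BorelSpace.measurable_eq`, the structure the two items speak about). -/
theorem radialKernel_of_pencil
    (hCKB : Summit.QuantumFields.YangMills.Theses.PencilRigidity.CurvatureKernelBound)
    (hSR : Summit.QuantumFields.YangMills.Theses.PencilRigidity.ShellRigidity) :
    ∀ (G : Type) [Group G] [TopologicalSpace G] [IsTopologicalGroup G] [CompactSpace G]
      [MeasurableSpace G] [BorelSpace G], IsCompactSimpleLieGroup G →
      ∀ (r : LatticeRep G) (sch : SpeciesScheme (YMSpecies G)) (S₁ : SchwingerFamily E4),
        W1 r sch S₁ → EightFrameRP S₁ → RadialKernel S₁ := by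
  intro G _ _ _ _ inst hB hG r sch S₁ hW h8
  have hBeq := hB.measurable_eq
  subst hBeq
  obtain ⟨Kf, C, η, hη, hKc, hKb, hKrep⟩ := hCKB G hG r sch S₁ hW
  obtain ⟨-, hOS, -, hhyp, -⟩ := hW
  obtain ⟨hWB4, hax, hdiag⟩ :=
    Summit.QuantumFields.YangMills.Theorems.KernelTransfer.kernelTransfer_proof S₁ Kf hKc hKrep
      hOS.2.2.2.2.1 hhyp h8
  exact ⟨Kf, hKc, fun R x hx => hSR Kf hKc ⟨C, η, hη, hKb⟩ hWB4 hax hdiag R x hx, hKrep⟩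

/-! ## The stub -/

/-- **Stub 5a — level growth at levels `a ≤ 1`** (signature verbatim as registered in the skeleton
`Cruxes/CurvatureBoostCovariance/Lines/boosts_inherit_mirrors.lean`).  Given `CurvatureKernelBound` and
`ShellRigidity` by name, for every compact simple `G`, `r`, `sch`, `S₁` with `W1 r sch S₁` and the eight frames,
every level `a ≤ 1`, every compactly supported time-ordered `F` of degree `a` and witness `H` of `ΘF* ⊗ F` whose
orbit function `θ ↦ S₁ (a + a) (R_θ · H)` is the trigonometric polynomial with coefficients `p`, the layers
`|k| ≥ 2` vanish: the orbit function is constant (`a = 0`: the action is trivial; `a = 1`: `radialKernel_of_pencil`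
and `radialKernel_invariant_two` on the off-diagonal `H`), and constant trigonometric polynomials have no layer
`k ≠ 0` (`trigPoly_coeff_eq_zero_of_const`).  The cone, the induction hypothesis and the compact support are unused. -/
theorem stub_levelGrowthLow :
    open Literature.MathematicalPhysics.QuantumLattice Literature.MathematicalPhysics.AQFT
      Literature.MathematicalPhysics.QuantumFieldTheory
      Summit.QuantumFields.YangMills.Theorems.CurvatureBoostCovariance.Negative
      Summit.QuantumFields.YangMills.Theorems.NPointIsotropy.Negative in
    Summit.QuantumFields.YangMills.Theses.PencilRigidity.CurvatureKernelBound →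
    Summit.QuantumFields.YangMills.Theses.PencilRigidity.ShellRigidity →
    ∀ (G : Type) [Group G] [TopologicalSpace G] [IsTopologicalGroup G] [CompactSpace G]
      [MeasurableSpace G] [BorelSpace G], IsCompactSimpleLieGroup G →
      ∀ (r : LatticeRep G) (sch : SpeciesScheme (YMSpecies G)) (S₁ : SchwingerFamily E4),
        W1 r sch S₁ → EightFrameRP S₁ → PlanarCone S₁ →
        ∀ a : ℕ, a ≤ 1 →
          (∀ N : ℕ, N + 2 ≤ 2 * a → ∀ R : E4 ≃ₗᵢ[ℝ] E4,
            LinearMap.det (R.toLinearEquiv : E4 →ₗ[ℝ] E4) = 1 →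
            R (EuclideanSpace.single 2 1) = EuclideanSpace.single 2 1 →
            R (EuclideanSpace.single 3 1) = EuclideanSpace.single 3 1 →
            ∀ F : SchwartzMap (Fin N → E4) ℂ, IsOffDiagonal F → S₁ N (linActMulti R F) = S₁ N F) →
          ∀ (F : SchwartzMap (Fin a → E4) ℂ), IsTimeOrdered F → HasCompactSupport (F : (Fin a → E4) → ℂ) →
          ∀ H : SchwartzMap (Fin (a + a) → E4) ℂ, IsAppendTensorOf H (osAdjoint F) F →
          ∀ (K : ℕ) (p : ℤ → ℂ),
            (∀ θ : ℝ, S₁ (a + a) (linActMulti (planeRot (0 : Fin 3) θ) H) =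
              ∑ k ∈ Finset.Icc (-(K : ℤ)) K, p k * Complex.exp (4 * (k : ℂ) * (θ : ℂ) * Complex.I)) →
            ∀ k ∈ Finset.Icc (-(K : ℤ)) K, 2 ≤ |k| → p k = 0 := by
  intro hCKB hSR G _ _ _ _ _ _ hG r sch S₁ hW h8 _ a ha _ F hF _ H hH K p hp
  -- Step 1: the orbit function of the doubled test function is constant
  have hconst : ∀ θ : ℝ, S₁ (a + a) (linActMulti (planeRot (0 : Fin 3) θ) H) = S₁ (a + a) H := by
    obtain rfl | rfl : a = 0 ∨ a = 1 := by omega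
    · -- level `a = 0`: the diagonal action is trivial on the one-point space `Fin (0 + 0) → ℝ⁴`
      intro θ
      congr 1
      ext x
      rw [linActMulti_apply]
      congr 1
      funext i
      exact Fin.elim0 i
    · -- level `a = 1`: radial two-point kernel, `H` off-diagonal
      have hrad : RadialKernel S₁ := radialKernel_of_pencil hCKB hSR G hG r sch S₁ hW h8
      have hHoff : IsOffDiagonal H := hH.isOffDiagonal_of_isTimeOrdered hF hF
      intro θ
      exact radialKernel_invariant_two hrad (planeRot (0 : Fin 3) θ) H hHoff
  -- Step 2: uniqueness of trigonometric coefficients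
  intro k hk hk2
  have hk0 : k ≠ 0 := by
    rintro rfl
    rw [abs_zero] at hk2
    exact absurd hk2 (by norm_num)
  exact trigPoly_coeff_eq_zero_of_const K p (S₁ (a + a) H) (fun θ => (hp θ).symm.trans (hconst θ)) k hk hk0

end Summit.QuantumFields.YangMills.Theorems.CurvatureBoostCovariance.BoostsInheritMirrors

end
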